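import Mathlib
import Summits.PneNP.PneNP.Theorems.ConvexRankGatesConvexGateBlindPoolCounting

/-!
# PneNP / ConvexRankGates — `ConvexGateBlind`: the pool measure (exact vertex and pair marginals)

Helpers (`--supports stmt-PneNP-10680`), COLUMN-SPACE line (prover seat 2, session 19); third brick of the unconditional
linear ℓ₁-bound. THE POOL MEASURE on `2r`-subsets of an ambient vertex set `U` (pool size `n ≥ 4`, bias `η`): choose a
uniformly random pool `P ∈ C(U,n)`, draw ONE ordered pair `(a,b)` inside it with weight
`ν(P,a,b) = (1 + η·rc_P F(a,b))/(n(n−1))` (`rc_P F` = `F` re-centred inside the pool, `…PoolRecentre`), and recurse with `r−1`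
pools inside `U ∖ P`. We only ever need its EXPECTATION FUNCTIONAL `poolE η n F r U g`, defined by this recursion. Results
(all exact, by induction on `r`): linearity and positivity; total mass `1` (`poolE_one`); VERTEX MARGINALS `2r/u`
(`poolE_vertex` — the bias is invisible to single vertices because `rc_P F` has zero row sums); PAIR MARGINALS
`α_r(u) + β_r(u)·rc_U F(x,y)` with `α_r(u) = 2r(2r−1)/(u(u−1))`, `β_r(u) = 2rη·c(u,n)/(u(u−1))` (`poolE_pair` — cross-pool
co-inclusions are `F`-free, the same-pool term is affine in `rc_P F`, and superset averaging (`…PoolCounting`) turns its pool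
average into `rc_U F`). [new]
-/

set_option linter.dupNamespace false

namespace Summit.PneNP.PneNP.Theorems

open Finset

noncomputable section

variable {m : ℕ}

/-! ## Definitions -/

/-- The weight of the ordered pair `(a,b)` inside the pool `P`: `(1 + η·rc_P F(a,b))/(n(n−1))`. [new] -/
def poolNu (η : ℝ) (n : ℕ) (F : Fin m → Fin m → ℝ) (P : Finset (Fin m)) (a b : Fin m) : ℝ :=
  (1 + η * poolRc P F a b) / ((n : ℝ) * ((n : ℝ) - 1))

/-- **The expectation functional of the pool measure** with `r` pools of size `n` inside `U`, applied to `g`: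
`E_0^U[g] = g ∅`, `E_{r+1}^U[g] = C(u,n)⁻¹ ∑_{P ∈ C(U,n)} ∑_{a ∈ P} ∑_{b ∈ P ∖ a} ν(P,a,b) · E_r^{U∖P}[Q ↦ g(Q ∪ {a,b})]`. [new] -/
def poolE (η : ℝ) (n : ℕ) (F : Fin m → Fin m → ℝ) : ℕ → Finset (Fin m) → (Finset (Fin m) → ℝ) → ℝ
  | 0, _, g => g ∅
  | r + 1, U, g => ((U.card.choose n : ℕ) : ℝ)⁻¹ *
      ∑ P ∈ U.powersetCard n, ∑ a ∈ P, ∑ b ∈ P.erase a,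
        poolNu η n F P a b * poolE η n F r (U \ P) (fun Q => g (insert a (insert b Q)))

variable (η : ℝ) (n : ℕ) (F : Fin m → Fin m → ℝ)

/-- The recursion, base case. [new] -/
theorem poolE_zero (U : Finset (Fin m)) (g : Finset (Fin m) → ℝ) : poolE η n F 0 U g = g ∅ := rfl

/-- The recursion, step. [new] -/
theorem poolE_succ (r : ℕ) (U : Finset (Fin m)) (g : Finset (Fin m) → ℝ) :
    poolE η n F (r + 1) U g = ((U.card.choose n : ℕ) : ℝ)⁻¹ *
      ∑ P ∈ U.powersetCard n, ∑ a ∈ P, ∑ b ∈ P.erase a,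
        poolNu η n F P a b * poolE η n F r (U \ P) (fun Q => g (insert a (insert b Q))) := rfl

/-! ## The pair weights: symmetry, row sums, positivity -/

/-- `ν(P,a,b) = ν(P,b,a)` for symmetric `F`. [new] -/
theorem poolNu_symm (hF : ∀ a b, F a b = F b a) (P : Finset (Fin m)) (a b : Fin m) :
    poolNu η n F P a b = poolNu η n F P b a := by
  unfold poolNu; rw [poolRc_symm P F hF]

/-- **Row sums of the pair weights:** `∑_{b ∈ P ∖ a} ν(P,a,b) = 1/n` for `a ∈ P`, `#P = n ≥ 3`. [new] -/
theorem sum_poolNu_row {P : Finset (Fin m)} (hP : P.card = n) (hn : 3 ≤ n) {a : Fin m} (ha : a ∈ P) :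
    ∑ b ∈ P.erase a, poolNu η n F P a b = 1 / n := by
  unfold poolNu
  rw [← Finset.sum_div, Finset.sum_add_distrib, Finset.sum_const, Finset.card_erase_of_mem ha, ← Finset.mul_sum,
    sum_poolRc_row P F ha (by omega), mul_zero, add_zero, nsmul_eq_mul, mul_one, hP,
    Nat.cast_sub (by omega), Nat.cast_one]
  have hn' : (3 : ℝ) ≤ n := by exact_mod_cast hn
  have h1 : (n : ℝ) - 1 ≠ 0 := by linarith
  have h2 : (n : ℝ) ≠ 0 := by linarith
  field_simp

/-- **Total of the pair weights:** `∑_{a ∈ P} ∑_{b ∈ P ∖ a} ν(P,a,b) = 1` (`#P = n ≥ 3`). [new] -/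
theorem sum_poolNu {P : Finset (Fin m)} (hP : P.card = n) (hn : 3 ≤ n) :
    ∑ a ∈ P, ∑ b ∈ P.erase a, poolNu η n F P a b = 1 := by
  rw [Finset.sum_congr rfl (fun a ha => sum_poolNu_row η n F hP hn ha), Finset.sum_const, hP, nsmul_eq_mul]
  have hn' : (3 : ℝ) ≤ n := by exact_mod_cast hn
  have h2 : (n : ℝ) ≠ 0 := by linarith
  field_simp

/-- **Column/vertex sums of the pair weights:** `∑_a ∑_{b ∈ P∖a} ν(P,a,b)·[x = a ∨ x = b] = 2/n` for `x ∈ P`. [new] -/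
theorem sum_poolNu_vertex (hF : ∀ a b, F a b = F b a) {P : Finset (Fin m)} (hP : P.card = n) (hn : 3 ≤ n)
    {x : Fin m} (hx : x ∈ P) :
    ∑ a ∈ P, ∑ b ∈ P.erase a, poolNu η n F P a b * (if x = a ∨ x = b then 1 else 0) = 2 / n := by
  classical
  -- split the indicator: `[x = a ∨ x = b] = [x = a] + [x = b]` on `b ≠ a`
  have hsplit : ∀ a ∈ P, ∀ b ∈ P.erase a,
      poolNu η n F P a b * (if x = a ∨ x = b then (1 : ℝ) else 0) =
        poolNu η n F P a b * (if x = a then 1 else 0) + poolNu η n F P a b * (if x = b then 1 else 0) := by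
    intro a _ b hb
    have hba : b ≠ a := (Finset.mem_erase.1 hb).1
    by_cases hxa : x = a
    · subst hxa
      simp [Ne.symm hba]
    · by_cases hxb : x = b
      · subst hxb
        simp [hxa]
      · simp [hxa, hxb]
  rw [Finset.sum_congr rfl (fun a ha => Finset.sum_congr rfl (fun b hb => hsplit a ha b hb))]
  simp_rw [Finset.sum_add_distrib]
  -- first part: only `a = x`
  have h1 : ∑ a ∈ P, ∑ b ∈ P.erase a, poolNu η n F P a b * (if x = a then (1 : ℝ) else 0) = 1 / n := by
    rw [← Finset.add_sum_erase _ _ hx]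
    have hzero : ∑ a ∈ P.erase x, ∑ b ∈ P.erase a, poolNu η n F P a b * (if x = a then (1 : ℝ) else 0) = 0 := by
      refine Finset.sum_eq_zero fun a ha => ?_
      have : x ≠ a := (Finset.mem_erase.1 ha).1.symm
      simp [this]
    rw [hzero, add_zero]
    simp only [if_true, mul_one]
    exact sum_poolNu_row η n F hP hn hx
  -- second part: only `b = x`
  have h2 : ∑ a ∈ P, ∑ b ∈ P.erase a, poolNu η n F P a b * (if x = b then (1 : ℝ) else 0) = 1 / n := by
    have hinner : ∀ a ∈ P, ∑ b ∈ P.erase a, poolNu η n F P a b * (if x = b then (1 : ℝ) else 0) =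
        if a = x then 0 else poolNu η n F P x a := by
      intro a ha
      by_cases hax : a = x
      · rw [if_pos hax]
        refine Finset.sum_eq_zero fun b hb => ?_
        have : x ≠ b := by rw [← hax]; exact (Finset.mem_erase.1 hb).1.symm
        simp [this]
      · rw [if_neg hax]
        have hxmem : x ∈ P.erase a := Finset.mem_erase.2 ⟨Ne.symm hax, hx⟩
        rw [← Finset.add_sum_erase _ _ hxmem]
        have hzero : ∑ b ∈ (P.erase a).erase x, poolNu η n F P a b * (if x = b then (1 : ℝ) else 0) = 0 := by
          refine Finset.sum_eq_zero fun b hb => ?_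
          have : x ≠ b := (Finset.mem_erase.1 hb).1.symm
          simp [this]
        rw [hzero, add_zero, if_pos rfl, mul_one, poolNu_symm η n F hF]
    rw [Finset.sum_congr rfl hinner, ← Finset.add_sum_erase _ _ hx, if_pos rfl, zero_add]
    have : ∑ a ∈ P.erase x, (if a = x then (0 : ℝ) else poolNu η n F P x a) = ∑ a ∈ P.erase x, poolNu η n F P x a :=
      Finset.sum_congr rfl fun a ha => by rw [if_neg (Finset.mem_erase.1 ha).1]
    rw [this]
    exact sum_poolNu_row η n F hP hn hx
  rw [h1, h2]
  ring

/-! ## Linearity, support, positivity of the functional -/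

/-- Linearity: sums. [new] -/
theorem poolE_add (r : ℕ) (U : Finset (Fin m)) (g h : Finset (Fin m) → ℝ) :
    poolE η n F r U (fun Q => g Q + h Q) = poolE η n F r U g + poolE η n F r U h := by
  induction r generalizing U g h with
  | zero => rfl
  | succ r ih =>
    rw [poolE_succ, poolE_succ, poolE_succ, ← mul_add, ← Finset.sum_add_distrib]
    congr 1
    refine Finset.sum_congr rfl fun P _ => ?_
    rw [← Finset.sum_add_distrib]
    refine Finset.sum_congr rfl fun a _ => ?_
    rw [← Finset.sum_add_distrib]
    refine Finset.sum_congr rfl fun b _ => ?_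
    rw [← mul_add, ← ih]

/-- Linearity: scalars. [new] -/
theorem poolE_smul (r : ℕ) (U : Finset (Fin m)) (c : ℝ) (g : Finset (Fin m) → ℝ) :
    poolE η n F r U (fun Q => c * g Q) = c * poolE η n F r U g := by
  induction r generalizing U g with
  | zero => rfl
  | succ r ih =>
    rw [poolE_succ, poolE_succ]
    have hP : ∀ P ∈ U.powersetCard n,
        ∑ a ∈ P, ∑ b ∈ P.erase a, poolNu η n F P a b *
            poolE η n F r (U \ P) (fun Q => c * g (insert a (insert b Q))) =
          c * ∑ a ∈ P, ∑ b ∈ P.erase a, poolNu η n F P a b *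
            poolE η n F r (U \ P) (fun Q => g (insert a (insert b Q))) := by
      intro P _
      rw [Finset.mul_sum]
      refine Finset.sum_congr rfl fun a _ => ?_
      rw [Finset.mul_sum]
      refine Finset.sum_congr rfl fun b _ => ?_
      rw [ih]
      ring
    rw [Finset.sum_congr rfl hP, ← Finset.mul_sum]
    ring

/-- Linearity: finite sums. [new] -/
theorem poolE_sum {ι : Type*} (s : Finset ι) (r : ℕ) (U : Finset (Fin m)) (g : ι → Finset (Fin m) → ℝ) :
    poolE η n F r U (fun Q => ∑ i ∈ s, g i Q) = ∑ i ∈ s, poolE η n F r U (g i) := by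
  classical
  induction s using Finset.induction_on with
  | empty =>
    simp only [Finset.sum_empty]
    have h := poolE_smul η n F r U 0 (fun _ => 0)
    simp only [zero_mul] at h
    exact h
  | insert i s hi ih =>
    rw [Finset.sum_insert hi, ← ih, ← poolE_add]
    exact congrArg _ (funext fun Q => Finset.sum_insert hi)

/-- **Support:** the functional only sees `g` on the `2r`-subsets of `U`. [new] -/
theorem poolE_congr_on (r : ℕ) (U : Finset (Fin m)) (g h : Finset (Fin m) → ℝ)
    (hgh : ∀ Q ⊆ U, Q.card = 2 * r → g Q = h Q) : poolE η n F r U g = poolE η n F r U h := by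
  induction r generalizing U g h with
  | zero => exact hgh ∅ (Finset.empty_subset _) (by simp)
  | succ r ih =>
    rw [poolE_succ, poolE_succ]
    congr 1
    refine Finset.sum_congr rfl fun P hP => ?_
    rw [Finset.mem_powersetCard] at hP
    refine Finset.sum_congr rfl fun a ha => ?_
    refine Finset.sum_congr rfl fun b hb => ?_
    congr 1
    refine ih (U \ P) _ _ fun Q hQ hQc => ?_
    have hba : b ≠ a := (Finset.mem_erase.1 hb).1
    have hbP : b ∈ P := (Finset.mem_erase.1 hb).2
    have haQ : a ∉ Q := fun h => (Finset.mem_sdiff.1 (hQ h)).2 ha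
    have hbQ : b ∉ Q := fun h => (Finset.mem_sdiff.1 (hQ h)).2 hbP
    refine hgh _ ?_ ?_
    · intro z hz
      rcases Finset.mem_insert.1 hz with rfl | hz
      · exact hP.1 ha
      rcases Finset.mem_insert.1 hz with rfl | hz
      · exact hP.1 hbP
      · exact (Finset.mem_sdiff.1 (hQ hz)).1
    · rw [Finset.card_insert_of_notMem (by simp [hba.symm, haQ]), Finset.card_insert_of_notMem hbQ, hQc]
      ring

/-- **Positivity:** if the pair weights are non-negative and `g ≥ 0` on the `2r`-subsets of `U`, then `E_r^U[g] ≥ 0`. [new] -/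
theorem poolE_nonneg (hν : ∀ (P : Finset (Fin m)) (a b : Fin m), P.card = n → a ∈ P → b ∈ P → 0 ≤ poolNu η n F P a b)
    (r : ℕ) (U : Finset (Fin m)) (g : Finset (Fin m) → ℝ) (hg : ∀ Q ⊆ U, Q.card = 2 * r → 0 ≤ g Q) :
    0 ≤ poolE η n F r U g := by
  induction r generalizing U g with
  | zero => exact hg ∅ (Finset.empty_subset _) (by simp)
  | succ r ih =>
    rw [poolE_succ]
    refine mul_nonneg (inv_nonneg.2 (Nat.cast_nonneg _)) (Finset.sum_nonneg fun P hP => ?_)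
    rw [Finset.mem_powersetCard] at hP
    refine Finset.sum_nonneg fun a ha => Finset.sum_nonneg fun b hb => ?_
    have hba : b ≠ a := (Finset.mem_erase.1 hb).1
    have hbP : b ∈ P := (Finset.mem_erase.1 hb).2
    refine mul_nonneg (hν P a b hP.2 ha hbP) (ih (U \ P) _ fun Q hQ hQc => ?_)
    have haQ : a ∉ Q := fun h => (Finset.mem_sdiff.1 (hQ h)).2 ha
    have hbQ : b ∉ Q := fun h => (Finset.mem_sdiff.1 (hQ h)).2 hbP
    refine hg _ ?_ ?_
    · intro z hz
      rcases Finset.mem_insert.1 hz with rfl | hz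
      · exact hP.1 ha
      rcases Finset.mem_insert.1 hz with rfl | hz
      · exact hP.1 hbP
      · exact (Finset.mem_sdiff.1 (hQ hz)).1
    · rw [Finset.card_insert_of_notMem (by simp [hba.symm, haQ]), Finset.card_insert_of_notMem hbQ, hQc]
      ring

/-! ## Total mass and vertex marginals -/

/-- **Total mass `1`:** `E_r^U[1] = 1` when `n·r ≤ #U` and `n ≥ 3`. [new] -/
theorem poolE_one (hn : 3 ≤ n) (r : ℕ) (U : Finset (Fin m)) (hU : n * r ≤ U.card) :
    poolE η n F r U (fun _ => 1) = 1 := by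
  induction r generalizing U with
  | zero => rfl
  | succ r ih =>
    rw [poolE_succ]
    have hnU : n ≤ U.card := le_trans (by nlinarith) hU
    have hstep : ∀ P ∈ U.powersetCard n,
        ∑ a ∈ P, ∑ b ∈ P.erase a, poolNu η n F P a b * poolE η n F r (U \ P) (fun _ => (1 : ℝ)) = 1 := by
      intro P hP
      rw [Finset.mem_powersetCard] at hP
      have hcard : n * r ≤ (U \ P).card := by
        rw [Finset.card_sdiff_of_subset hP.1, hP.2]
        have : n * (r + 1) = n * r + n := by ring
        omega
      rw [Finset.sum_congr rfl (fun a _ => Finset.sum_congr rfl (fun b _ => by rw [ih (U \ P) hcard, mul_one]))]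
      exact sum_poolNu η n F hP.2 hn
    rw [Finset.sum_congr rfl hstep, Finset.sum_const, Finset.card_powersetCard, nsmul_eq_mul, mul_one]
    have hpos : ((U.card.choose n : ℕ) : ℝ) ≠ 0 := by
      exact_mod_cast (Nat.choose_pos hnU).ne'
    exact inv_mul_cancel₀ hpos

/-- **Vertex marginals of the pool measure:** `E_r^U[x ∈ Q] = 2r/u` for `x ∈ U` (and `0` for `x ∉ U`), whenever
`n·r ≤ u`, `n ≥ 3`. The bias `η` does not enter: single vertices do not see it (zero row sums of `rc_P F`). [new] -/
theorem poolE_vertex (hF : ∀ a b, F a b = F b a) (hn : 3 ≤ n) (x : Fin m) (r : ℕ) (U : Finset (Fin m))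
    (hU : n * r ≤ U.card) :
    poolE η n F r U (fun Q => if x ∈ Q then 1 else 0) = if x ∈ U then 2 * (r : ℝ) / (U.card : ℝ) else 0 := by
  classical
  induction r generalizing U with
  | zero => simp [poolE_zero]
  | succ r ih =>
    rw [poolE_succ]
    have hnU : n ≤ U.card := le_trans (by nlinarith) hU
    -- the inner expectation
    have hinner : ∀ P ∈ U.powersetCard n, ∀ a ∈ P, ∀ b ∈ P.erase a,
        poolE η n F r (U \ P) (fun Q => if x ∈ insert a (insert b Q) then (1 : ℝ) else 0) =
          if x = a ∨ x = b then 1 else (if x ∈ U \ P then 2 * (r : ℝ) / ((U \ P).card : ℝ) else 0) := by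
      intro P hP a ha b hb
      rw [Finset.mem_powersetCard] at hP
      have hcard : n * r ≤ (U \ P).card := by
        rw [Finset.card_sdiff_of_subset hP.1, hP.2]
        have : n * (r + 1) = n * r + n := by ring
        omega
      by_cases hab : x = a ∨ x = b
      · rw [if_pos hab]
        have : (fun Q : Finset (Fin m) => if x ∈ insert a (insert b Q) then (1 : ℝ) else 0) = fun _ => 1 := by
          funext Q
          rw [if_pos]
          rcases hab with rfl | rfl <;> simp
        rw [this]
        exact poolE_one η n F hn r (U \ P) hcard
      · rw [if_neg hab]
        rw [not_or] at hab
        have : (fun Q : Finset (Fin m) => if x ∈ insert a (insert b Q) then (1 : ℝ) else 0) =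
            fun Q => if x ∈ Q then 1 else 0 := by
          funext Q
          simp [Finset.mem_insert, hab.1, hab.2]
        rw [this]
        exact ih (U \ P) hcard
    -- the pool sums
    have hS : ∀ P ∈ U.powersetCard n,
        ∑ a ∈ P, ∑ b ∈ P.erase a, poolNu η n F P a b *
            poolE η n F r (U \ P) (fun Q => if x ∈ insert a (insert b Q) then (1 : ℝ) else 0) =
          if x ∈ P then 2 / (n : ℝ) else (if x ∈ U \ P then 2 * (r : ℝ) / ((U \ P).card : ℝ) else 0) := by
      intro P hP
      have hP' := Finset.mem_powersetCard.1 hP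
      rw [Finset.sum_congr rfl (fun a ha => Finset.sum_congr rfl (fun b hb => by rw [hinner P hP a ha b hb]))]
      by_cases hxP : x ∈ P
      · rw [if_pos hxP]
        have hnot : x ∉ U \ P := fun h => (Finset.mem_sdiff.1 h).2 hxP
        simp only [hnot, if_false]
        exact sum_poolNu_vertex η n F hF hP'.2 hn hxP
      · rw [if_neg hxP]
        have hval : ∀ a ∈ P, ∀ b ∈ P.erase a,
            poolNu η n F P a b * (if x = a ∨ x = b then (1 : ℝ) else
              (if x ∈ U \ P then 2 * (r : ℝ) / ((U \ P).card : ℝ) else 0)) =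
            poolNu η n F P a b * (if x ∈ U \ P then 2 * (r : ℝ) / ((U \ P).card : ℝ) else 0) := by
          intro a ha b hb
          have hxa : x ≠ a := fun h => hxP (h ▸ ha)
          have hxb : x ≠ b := fun h => hxP (h ▸ (Finset.mem_erase.1 hb).2)
          rw [if_neg (not_or.2 ⟨hxa, hxb⟩)]
        rw [Finset.sum_congr rfl (fun a ha => Finset.sum_congr rfl (fun b hb => hval a ha b hb))]
        simp_rw [← Finset.sum_mul]
        rw [sum_poolNu η n F hP'.2 hn, one_mul]
    rw [Finset.sum_congr rfl hS]
    -- evaluate the sum over pools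
    by_cases hxU : x ∈ U
    · rw [if_pos hxU]
      rw [← Finset.sum_filter_add_sum_filter_not (U.powersetCard n) (fun P => x ∈ P)]
      have h1 : ∑ P ∈ (U.powersetCard n).filter (fun P => x ∈ P),
          (if x ∈ P then 2 / (n : ℝ) else (if x ∈ U \ P then 2 * (r : ℝ) / ((U \ P).card : ℝ) else 0)) =
          ((U.card - 1).choose (n - 1) : ℝ) * (2 / (n : ℝ)) := by
        rw [Finset.sum_congr rfl (fun P hP => by rw [if_pos (Finset.mem_filter.1 hP).2]), Finset.sum_const,
          nsmul_eq_mul, card_pools_mem U hxU (by omega)]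
      have h2 : ∑ P ∈ (U.powersetCard n).filter (fun P => ¬ x ∈ P),
          (if x ∈ P then 2 / (n : ℝ) else (if x ∈ U \ P then 2 * (r : ℝ) / ((U \ P).card : ℝ) else 0)) =
          ((U.card - 1).choose n : ℝ) * (2 * (r : ℝ) / ((U.card : ℝ) - n)) := by
        have hval : ∀ P ∈ (U.powersetCard n).filter (fun P => ¬ x ∈ P),
            (if x ∈ P then 2 / (n : ℝ) else (if x ∈ U \ P then 2 * (r : ℝ) / ((U \ P).card : ℝ) else 0)) =
              2 * (r : ℝ) / ((U.card : ℝ) - n) := by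
          intro P hP
          rw [Finset.mem_filter, Finset.mem_powersetCard] at hP
          rw [if_neg hP.2, if_pos (Finset.mem_sdiff.2 ⟨hxU, hP.2⟩), Finset.card_sdiff_of_subset hP.1.1, hP.1.2,
            Nat.cast_sub hnU]
        rw [Finset.sum_congr rfl hval, Finset.sum_const, nsmul_eq_mul, card_pools_not_mem U hxU n]
      rw [h1, h2]
      -- binomial algebra: `A = C(u-1,n-1) = nC/u`, `B = C(u-1,n) = (u-n)C/u`, `C = C(u,n)`
      have hu3 : (3 : ℝ) ≤ U.card := by exact_mod_cast le_trans hn hnU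
      have hn3 : (3 : ℝ) ≤ n := by exact_mod_cast hn
      have hC0 : ((U.card.choose n : ℕ) : ℝ) ≠ 0 := by exact_mod_cast (Nat.choose_pos hnU).ne'
      have hu0 : (U.card : ℝ) ≠ 0 := by linarith
      have hn0 : (n : ℝ) ≠ 0 := by linarith
      have hA := cast_mul_choose_predSub U.card n (by omega) hnU
      have hB := cast_mul_choose_predCompl U.card n (by omega) hnU
      have hA' : ((U.card - 1).choose (n - 1) : ℝ) = (n : ℝ) * (U.card.choose n : ℝ) / U.card := by
        rw [eq_div_iff hu0]; linear_combination hA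
      have hB' : ((U.card - 1).choose n : ℝ) = ((U.card : ℝ) - n) * (U.card.choose n : ℝ) / U.card := by
        rw [eq_div_iff hu0]; linear_combination hB
      rw [hA', hB']
      push_cast
      rcases eq_or_lt_of_le hnU with heq | hlt
      · -- `u = n`: then `r = 0`
        have hr : r = 0 := by
          rcases Nat.eq_zero_or_pos r with h | h
          · exact h
          · exfalso
            have : n * (r + 1) ≥ n * 2 := Nat.mul_le_mul_left n (by omega)
            omega
        subst hr
        simp only [Nat.cast_zero, mul_zero, zero_div, add_zero, zero_add, mul_one]
        field_simp
      · have hun : (U.card : ℝ) - n ≠ 0 := by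
          have : (n : ℝ) < U.card := by exact_mod_cast hlt
          linarith
        field_simp
        ring
    · rw [if_neg hxU]
      have hzero : ∀ P ∈ U.powersetCard n,
          (if x ∈ P then 2 / (n : ℝ) else (if x ∈ U \ P then 2 * (r : ℝ) / ((U \ P).card : ℝ) else 0)) = 0 := by
        intro P hP
        rw [Finset.mem_powersetCard] at hP
        have hxP : x ∉ P := fun h => hxU (hP.1 h)
        have hxUP : x ∉ U \ P := fun h => hxU (Finset.mem_sdiff.1 h).1
        rw [if_neg hxP, if_neg hxUP]
      rw [Finset.sum_congr rfl hzero, Finset.sum_const_zero, mul_zero]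

/-- **Vertex marginals of the pool measure** (registered form of `poolE_vertex`). [new] -/
theorem pool_vertex_marginal : ∀ {m : ℕ} (η : ℝ) (n : ℕ) (F : Fin m → Fin m → ℝ), (∀ a b, F a b = F b a) → 3 ≤ n → ∀ (x : Fin m) (r : ℕ) (U : Finset (Fin m)), n * r ≤ U.card → poolE η n F r U (fun Q => if x ∈ Q then 1 else 0) = if x ∈ U then 2 * (r : ℝ) / (U.card : ℝ) else 0 :=
  fun η n F hF hn x r U hU => poolE_vertex η n F hF hn x r U hU

end

end Summit.PneNP.PneNP.Theorems
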